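import Summits.KontsevichZagierPeriods.KontsevichZagierPeriods.Theorems.TerasomaMultiplicationGammaHodgeSectorMultiplicationNecessary
import Literature.NumberTheory.Transcendental.KZBetaUnitExponent

/-!
# `GammaHodgeSector` (stmt-KontsevichZagierPeriods-3742) CONTAINS `MultiplicationAccessible`
# (stmt-KontsevichZagierPeriods-12305): the integral locus and the unconditional containment

Crux `Summit.KontsevichZagierPeriods.KontsevichZagierPeriods.Theses.TerasomaMultiplication.GammaHodgeSector`
(Deligne / Koblitz–Ogus Hodge-type Beta identities inside the Kontsevich–Zagier rules; shared
verbatim with route MotivatedMoves). File `…GammaHodgeSectorMultiplicationNecessary.lean` proved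
`GammaHodgeSector →` the instance `(m, s)` of `MultiplicationAccessible` for `m < den s`. Here the
remaining INTEGRAL LOCUS `den s ≤ m` is settled and the containment becomes unconditional:

* `betaClass_natCast_right`, `betaClass_eq_kap_of_fract_eq_zero` — a Beta class with an INTEGRAL
  exponent is a CONSTANT of `P`: `betaClass a N = κ(B(a, N))` (`β(a,1) ∼ [pt, 1/a]` by the
  Literature move lemma `KZ.betaFirst_equivalent_unit_constMul`, then the line's translation relator
  and symmetry; the constant is pinned by evaluation, which also shows `B(a, N)` is algebraic);
* `multiplicationAccessible_of_den_eq_one` — for INTEGER `s` both sides of the instance are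
  constants, equal by Gauss's multiplication formula in Beta form (`prod_beta_mult`): NO hypothesis;
* `multiplicationAccessible_of_gammaHodgeSector_of_two_le_den` — for `2 ≤ den s ≤ m` the simplex
  factors `β(s, (j+1)s)` with `den s ∣ j+1` are constants and are moved into `c`; the crux applied
  to the box data against the KEPT factors (re-indexed to `Fin N''`; Hodge test inherited from
  `hodgeCondition_mult` since the dropped terms vanish; Deligne identity from `prod_beta_mult`) gives
  the box ∼ simplex equivalence;
* `multiplicationAccessible_of_gammaHodgeSector` — **`GammaHodgeSector → MultiplicationAccessible`**
  (and the MotivatedMoves copy), `gammaHodgeSector_iff_and_multiplicationAccessible`.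

So crux 3 of route TerasomaMultiplication is a SUB-CRUX of crux 5: with the landed
`gammaHodgeSector_of_selbergPositiveCancellation` (`12305 ∧ 5621 → 3742`) the net statement is
`3742 ⟺ 12305 ∧ [3742 given 12305]`, `12305 ∧ 5621 ⟹ 3742 ⟹ 12305`. No new definitions, no named
facts. References: Deligne, LNM 900 §7 (Thm 7.18); Andrews–Askey–Roy 1999, Thm 1.5.2;
Kontsevich–Zagier 2001 §1.2.
-/

noncomputable section

open MeasureTheory Set
open scoped BigOperators

namespace Summit.KontsevichZagierPeriods.GammaHodgeSectorKO

open Literature.NumberTheory.Transcendental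
open Literature.NumberTheory.Transcendental.KZ
open Summit.KontsevichZagierPeriods.GammaHodgeSectorNegative (Admissible CoprimeDen hodgeSum
  HodgeCondition IsCubeBetaRep IsBallCubeRep DeligneIdentity cubeRep ballCubeRep
  isBallCubeRep_ballCubeRep equivalent_cubeRep_of_isCubeBetaRep gammaHodgeSector_iff_canonical)
open Summit.KontsevichZagierPeriods.KontsevichZagierPeriods.Theses.TerasomaMultiplication
  (GammaHodgeSector MultiplicationAccessible)

/-! ## §5 Beta classes with an integral exponent are constants of `P` -/

/-- If `k s` is an integer (`k ≥ 1`) then `den s ∣ k`. [folklore] -/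
theorem den_dvd_of_fract_natCast_mul_eq_zero {s : ℚ} {k : ℕ} (hk : 0 < k)
    (h : Int.fract ((k : ℚ) * s) = 0) : s.den ∣ k := by
  rw [Int.fract_eq_zero_iff] at h
  obtain ⟨z, hz⟩ := h
  have hk0 : (k : ℚ) ≠ 0 := by exact_mod_cast hk.ne'
  have hs' : s = (z : ℚ) / ((k : ℤ) : ℚ) := by
    rw [Int.cast_natCast, eq_div_iff hk0, mul_comm]; exact hz.symm
  have hdvd : (s.den : ℤ) ∣ (k : ℤ) := by
    have h := Rat.den_dvd z k
    rwa [← Rat.intCast_div_eq_divInt, ← hs'] at h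
  exact_mod_cast hdvd

/-- If `den s ∣ k` then `k s` is an integer. [folklore] -/
theorem fract_natCast_mul_eq_zero_of_den_dvd {s : ℚ} {k : ℕ} (h : s.den ∣ k) :
    Int.fract ((k : ℚ) * s) = 0 := by
  obtain ⟨t, rfl⟩ := h
  rw [Int.fract_eq_zero_iff]
  refine ⟨t * s.num, ?_⟩
  push_cast
  rw [← Rat.mul_den_eq_num s]
  ring

/-- **`β(a, N)` is a constant of `P` for a natural exponent `N ≥ 1`**: `betaClass a N = κ(B(a, N))`
(and `B(a, N)` is a real algebraic number): `β(a,1) ∼ [pt, 1/a]` (`KZ.betaFirst_equivalent_unit_constMul`,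
one Newton–Leibniz move) and the translation relator `β(N, a) = κ·β(N+1, a)` of the line
(`stub_betaRelators`), with symmetry; the constant is pinned by evaluation. [folklore] -/
theorem betaClass_natCast_right (a : ℚ) (ha : 0 < a) :
    ∀ N : ℕ, 1 ≤ N → ∃ hc : IsAlgebraic ℚ (ProbabilityTheory.beta a N),
      betaClass a N = kap (ProbabilityTheory.beta a N) hc := by
  -- it suffices to produce SOME algebraic constant: evaluation pins it
  suffices H : ∀ N : ℕ, 1 ≤ N → ∃ (c : ℝ) (hc : IsAlgebraic ℚ c), betaClass a N = kap c hc by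
    intro N hN
    obtain ⟨c, hc, h⟩ := H N hN
    have hNq : (0 : ℚ) < N := by exact_mod_cast hN
    have hcv : c = ProbabilityTheory.beta a N := by
      have h1 := congrArg evalP h
      rw [evalP_betaClass a N ha hNq, evalP_kap] at h1
      push_cast at h1
      exact h1.symm
    subst hcv
    exact ⟨hc, h⟩
  intro N hN
  induction N, hN using Nat.le_induction with
  | base =>
    have hqa : IsAlgebraic ℚ ((a : ℚ) : ℝ) := isAlgebraic_algebraMap a
    have hinv : IsAlgebraic ℚ ((a : ℝ)⁻¹) := hqa.inv
    refine ⟨(a : ℝ)⁻¹, hinv, ?_⟩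
    rw [Nat.cast_one, betaClass_eq a 1 ha one_pos, kap]
    exact (betaFirst_equivalent_unit_constMul a ha (betaRep a 1 ha one_pos) rfl
      (fun _ _ => rfl) hinv).toFormalPeriod_eq
  | succ N hN ih =>
    obtain ⟨c, hc, h⟩ := ih
    have hNq : (0 : ℚ) < N := by exact_mod_cast hN
    obtain ⟨hsymm, htr, -⟩ := stub_betaRelators
    -- translation in the first slot of `β(N, a)`: `β(N, a) = κ(q) β(N+1, a)`
    obtain ⟨q, hq, hqpos, hqe⟩ := htr (N : ℚ) a hNq ha
    refine ⟨q⁻¹ * c, hq.inv.mul hc, ?_⟩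
    push_cast
    rw [hsymm a ((N : ℚ) + 1) ha (by positivity), kap_mul q⁻¹ c hq.inv hc, ← h, hsymm a N ha hNq, hqe,
      ← mul_assoc,
      mul_comm (kap q⁻¹ hq.inv), kap_mul_kap_inv hq hqpos.ne', one_mul]

/-- Products of constants are constants: if every `f i` (`i ∈ s`) is `κ(g i)` then
`∏_{i∈s} f i = κ(∏_{i∈s} g i)`. [folklore] -/
theorem prod_eq_kap_prod {ι : Type*} (s : Finset ι) (f : ι → FormalPeriodRing) (g : ι → ℝ)
    (h : ∀ i ∈ s, ∃ hc : IsAlgebraic ℚ (g i), f i = kap (g i) hc) :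
    ∃ hc : IsAlgebraic ℚ (∏ i ∈ s, g i), ∏ i ∈ s, f i = kap (∏ i ∈ s, g i) hc := by
  classical
  induction s using Finset.induction_on with
  | empty => exact ⟨by simpa using isAlgebraic_one, by simp [kap_one]⟩
  | insert i s hi ih =>
    obtain ⟨hci, hi_eq⟩ := h i (Finset.mem_insert_self i s)
    obtain ⟨hcs, hs_eq⟩ := ih fun j hj => h j (Finset.mem_insert_of_mem hj)
    refine ⟨by rw [Finset.prod_insert hi]; exact hci.mul hcs, ?_⟩
    rw [Finset.prod_insert hi (f := f), hi_eq, hs_eq, ← kap_mul (g i) _ hci hcs]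
    exact kap_congr _ _ (Finset.prod_insert hi).symm

/-- A Beta class whose second exponent is a (positive) integer is the constant `κ(B(a, b))`.
[folklore] -/
theorem betaClass_eq_kap_of_fract_eq_zero (a b : ℚ) (ha : 0 < a) (hb : 0 < b)
    (hbZ : Int.fract b = 0) :
    ∃ hc : IsAlgebraic ℚ (ProbabilityTheory.beta a b), betaClass a b = kap (ProbabilityTheory.beta a b) hc := by
  rw [Int.fract_eq_zero_iff] at hbZ
  obtain ⟨z, hz⟩ := hbZ
  have hz0 : 0 ≤ z := by
    have : (0 : ℚ) < z := by rw [hz]; exact hb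
    exact_mod_cast this.le
  have hN : ((z.toNat : ℕ) : ℚ) = b := by
    rw [← hz]; exact_mod_cast Int.toNat_of_nonneg hz0
  have hN1 : 1 ≤ z.toNat := by
    have : (0 : ℚ) < (z.toNat : ℕ) := by rw [hN]; exact hb
    exact_mod_cast this
  subst hN
  obtain ⟨hc, h⟩ := betaClass_natCast_right a ha z.toNat hN1
  simp only [Rat.cast_natCast]
  exact ⟨hc, h⟩

/-! ## §6 The integral locus `den s ≤ m` -/

/-- **Integer `s`: the multiplication pair is a pair of constants.** For `s ∈ ℕ` both sides of the
instance `(m, s)` of `MultiplicationAccessible` have classes `κ(∏ B((i+1)/n, s))` and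
`κ(n^{ns−1} ∏ B(s, (j+1)s))` (all Beta factors have an integral exponent), equal by Gauss's
multiplication formula in Beta form; no hypothesis is needed. [cite: AndrewsAskeyRoy1999, Thm 1.5.2] -/
theorem multiplicationAccessible_of_den_eq_one (m : ℕ) (s : ℚ) (hs : 0 < s) (hd : s.den = 1)
    (r r' : IntegralRep m) (hrd : r.domain = {x | ∀ i, x i ∈ Set.Ioo (0:ℝ) 1})
    (hri : Set.EqOn r.integrand (fun x => ∏ i : Fin m,
      (x i) ^ ((((i:ℕ):ℝ) + 1) / ((m:ℝ) + 1) - 1) * (1 - x i) ^ ((s:ℝ) - 1)) r.domain)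
    (hr'd : r'.domain = {x | (∀ i, 0 < x i) ∧ ∑ i, x i < (m:ℝ) + 1})
    (hr'i : Set.EqOn r'.integrand
      (fun x => ((∏ i, x i) * ((m:ℝ) + 1 - ∑ i, x i)) ^ ((s:ℝ) - 1)) r'.domain) :
    Equivalent r r' := by
  classical
  set x : Fin m → ℚ := fun i => (((i : ℕ) : ℚ) + 1) / ((m : ℚ) + 1) with hxdef
  set y : Fin m → ℚ := fun _ => s with hydef
  set y' : Fin m → ℚ := fun j => (((j : ℕ) : ℚ) + 1) * s with hy'def
  have hy'nat : ∀ j : Fin m, y' j = (((j : ℕ) + 1 : ℕ) : ℚ) * s := fun j => by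
    simp only [hy'def]; push_cast; ring
  have hpos : ∀ i, 0 < x i ∧ 0 < y i := fun i => ⟨by positivity, hs⟩
  have hy'pos : ∀ j, 0 < y' j := fun j => by positivity
  set κ : ℝ := ((m:ℝ) + 1) ^ (((m:ℝ) + 1) * s - 1) with hκdef
  have hκ : IsAlgebraic ℚ κ := isAlgebraic_gaussMultConst m s
  have hsR : (0 : ℝ) < (s : ℝ) := by exact_mod_cast hs
  have hsZ : Int.fract s = 0 := Int.fract_eq_zero_iff.mpr ⟨s.num, Rat.coe_int_num_of_den_eq_one hd⟩
  have hy'Z : ∀ j : Fin m, Int.fract (y' j) = 0 := fun j => by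
    rw [hy'nat]; exact fract_natCast_mul_eq_zero_of_den_dvd (by rw [hd]; exact one_dvd _)
  -- box side: a product of constants
  have hr : IsCubeBetaRep x y r := isCubeBetaRep_multBox m s r hrd hri
  have e1 : toFormalPeriod (of r) = ∏ i, betaClass (x i) s := cubeProduct_holds x y r hpos hr
  obtain ⟨hcL, eL⟩ := prod_eq_kap_prod Finset.univ (fun i => betaClass (x i) s)
    (fun i => ProbabilityTheory.beta (x i : ℝ) (s : ℝ))
    (fun i _ => betaClass_eq_kap_of_fract_eq_zero (x i) s (hpos i).1 hs hsZ)
  -- simplex side: `κ` times a product of constants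
  have e3 : toFormalPeriod (of r') =
      kap κ hκ * ∏ j, toFormalPeriod (of (betaRep s (y' j) hs (hy'pos j))) :=
    bigSimplex_toFormalPeriod m s hs r' hr'd hr'i y' (fun j => rfl)
      (fun j => betaRep s (y' j) hs (hy'pos j)) (fun j => rfl) (fun j => fun _ _ => rfl) hκ
  have e4 : ∏ j, toFormalPeriod (of (betaRep s (y' j) hs (hy'pos j))) = ∏ j, betaClass s (y' j) :=
    Finset.prod_congr rfl fun j _ => (betaClass_eq s (y' j) hs (hy'pos j)).symm
  obtain ⟨hcR, eR⟩ := prod_eq_kap_prod Finset.univ (fun j => betaClass s (y' j))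
    (fun j => ProbabilityTheory.beta (s : ℝ) (y' j : ℝ))
    (fun j _ => betaClass_eq_kap_of_fract_eq_zero s (y' j) hs (hy'pos j) (hy'Z j))
  -- compare the two constants by evaluation (Gauss multiplication in Beta form)
  have hxR : ∀ i : Fin m, ((x i : ℚ) : ℝ) = (((i : ℕ) : ℝ) + 1) / ((m : ℝ) + 1) := fun i => by
    simp only [hxdef]; push_cast; ring
  have hy'R : ∀ j : Fin m, ((y' j : ℚ) : ℝ) = (((j : ℕ) : ℝ) + 1) * s := fun j => by
    simp only [hy'def]; push_cast; ring
  have hmain : ∏ i : Fin m, ProbabilityTheory.beta ((x i : ℚ) : ℝ) (s : ℝ) =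
      κ * ∏ j : Fin m, ProbabilityTheory.beta (s : ℝ) (y' j) := by
    have h0 := prod_beta_mult m hsR
    simp only [hxR]
    rw [h0]
    congr 1
    exact Finset.prod_congr rfl fun j _ => by rw [hy'R]
  change of r - of r' ∈ relations
  rw [← toFormalPeriod_eq_iff, e1, eL, e3, e4, eR, ← kap_mul κ _ hκ hcR]
  exact kap_congr _ _ hmain

/-- **The Γ-Hodge sector contains the multiplication family on the integral locus
`2 ≤ den s ≤ m`.** Split the simplex-side factors `β(s, (j+1)s)` into those with `den s ∤ j+1`
(admissible) and those with `den s ∣ j+1` (integral second exponent, hence CONSTANTS of `P`,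
`betaClass_eq_kap_of_fract_eq_zero`); the crux applied to the box data against the kept factors
(Hodge test inherited from `hodgeCondition_mult` — the dropped terms vanish — and Deligne identity
from `prod_beta_mult` with the constant `κ · ∏_dropped B(s, (j+1)s)`) gives the box ∼ simplex
equivalence again. [cite: Deligne1982HodgeCycles, Thm. 7.18] -/
theorem multiplicationAccessible_of_gammaHodgeSector_of_two_le_den (h : GammaHodgeSector)
    (m : ℕ) (s : ℚ) (hm : 1 ≤ m) (hs : 0 < s) (hd2 : 2 ≤ s.den)
    (r r' : IntegralRep m) (hrd : r.domain = {x | ∀ i, x i ∈ Set.Ioo (0:ℝ) 1})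
    (hri : Set.EqOn r.integrand (fun x => ∏ i : Fin m,
      (x i) ^ ((((i:ℕ):ℝ) + 1) / ((m:ℝ) + 1) - 1) * (1 - x i) ^ ((s:ℝ) - 1)) r.domain)
    (hr'd : r'.domain = {x | (∀ i, 0 < x i) ∧ ∑ i, x i < (m:ℝ) + 1})
    (hr'i : Set.EqOn r'.integrand
      (fun x => ((∏ i, x i) * ((m:ℝ) + 1 - ∑ i, x i)) ^ ((s:ℝ) - 1)) r'.domain) :
    Equivalent r r' := by
  classical
  -- the data of the pair
  set x : Fin m → ℚ := fun i => (((i : ℕ) : ℚ) + 1) / ((m : ℚ) + 1) with hxdef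
  set y : Fin m → ℚ := fun _ => s with hydef
  set y' : Fin m → ℚ := fun j => (((j : ℕ) : ℚ) + 1) * s with hy'def
  have hy'nat : ∀ j : Fin m, y' j = (((j : ℕ) + 1 : ℕ) : ℚ) * s := fun j => by
    simp only [hy'def]; push_cast; ring
  have hy'pos : ∀ j, 0 < y' j := fun j => by positivity
  -- the kept factors: `den s ∤ j + 1`
  set p : Fin m → Prop := fun j => ¬ s.den ∣ (j : ℕ) + 1 with hpdef
  set K := {j : Fin m // p j} with hKdef
  set e : K ≃ Fin (Fintype.card K) := Fintype.equivFin K with hedef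
  set x'' : Fin (Fintype.card K) → ℚ := fun _ => s with hx''def
  set y'' : Fin (Fintype.card K) → ℚ := fun l => y' ((e.symm l : K) : Fin m) with hy''def
  -- integrality bookkeeping
  have hfract_kept : ∀ j : Fin m, p j → Int.fract (y' j) ≠ 0 := fun j hj h0 =>
    hj (den_dvd_of_fract_natCast_mul_eq_zero (Nat.succ_pos _) (by rw [← hy'nat]; exact h0))
  have hfract_drop : ∀ j : Fin m, ¬ p j → Int.fract (y' j) = 0 := fun j hj => by
    rw [hy'nat]; exact fract_natCast_mul_eq_zero_of_den_dvd (not_not.mp hj)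
  have hsZ : Int.fract s ≠ 0 := fun h0 => by
    have h1 : s.den ∣ 1 := den_dvd_of_fract_natCast_mul_eq_zero one_pos (by simpa using h0)
    have := Nat.le_of_dvd one_pos h1
    omega
  -- admissibility
  have hx : Admissible x y := admissible_multL m hs hsZ
  have hx'' : Admissible x'' y'' := fun l =>
    ⟨hs, hy'pos _, hsZ, hfract_kept _ (e.symm l).2⟩
  -- re-indexing of sums / products over the kept factors
  have hsumK : ∀ f : Fin m → ℚ, ∑ j ∈ Finset.univ.filter p, f j = ∑ l, f ((e.symm l : K) : Fin m) := by
    intro f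
    rw [Finset.sum_subtype (Finset.univ.filter p) (p := p) (fun j => by simp)]
    exact Fintype.sum_equiv e _ _ fun j => by simp
  have hprodK : ∀ {M : Type} [CommMonoid M] (f : Fin m → M),
      ∏ j ∈ Finset.univ.filter p, f j = ∏ l, f ((e.symm l : K) : Fin m) := by
    intro M _ f
    rw [Finset.prod_subtype (Finset.univ.filter p) (p := p) (fun j => by simp)]
    exact Fintype.prod_equiv e _ _ fun j => by simp
  -- the Hodge test of the reduced pair
  have hH : HodgeCondition m (Fintype.card K) 0 x y x'' y'' := by
    intro u hu hcop _
    have hcs : Nat.Coprime u s.den := (hcop ⟨0, hm⟩).2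
    have hcop' : CoprimeDen (fun _ : Fin m => s) y' u := fun j => ⟨hcs, by
      refine Nat.Coprime.coprime_dvd_right ?_ hcs
      rw [hy'nat]
      exact (Rat.mul_den_dvd _ _).trans (by simp)⟩
    have hfull := hodgeCondition_mult m s hm u hu hcop hcop'
    suffices hred : hodgeSum x'' y'' u = hodgeSum (fun _ : Fin m => s) y' u by rw [hred]; exact hfull
    unfold hodgeSum
    rw [← Finset.sum_filter_add_sum_filter_not Finset.univ p, hsumK]
    have hzero : ∑ j ∈ Finset.univ.filter (fun j => ¬ p j),
        (Int.fract ((u : ℚ) * s) + Int.fract ((u : ℚ) * y' j) - Int.fract ((u : ℚ) * (s + y' j))) = 0 := by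
      refine Finset.sum_eq_zero fun j hj => ?_
      have hj : ¬ p j := (Finset.mem_filter.mp hj).2
      obtain ⟨z, hz⟩ := Int.fract_eq_zero_iff.mp (hfract_drop j hj)
      rw [← hz, show (u : ℚ) * (z : ℚ) = (((u : ℤ) * z : ℤ) : ℚ) by push_cast; ring, Int.fract_intCast,
        mul_add, show (u : ℚ) * (z : ℚ) = (((u : ℤ) * z : ℤ) : ℚ) by push_cast; ring, Int.fract_add_intCast]
      ring
    rw [hzero, add_zero]
  -- the Deligne identity of the reduced pair
  set κ : ℝ := ((m:ℝ) + 1) ^ (((m:ℝ) + 1) * s - 1) with hκdef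
  have hκ : IsAlgebraic ℚ κ := isAlgebraic_gaussMultConst m s
  have hsR : (0 : ℝ) < (s : ℝ) := by exact_mod_cast hs
  have hxR : ∀ i : Fin m, ((x i : ℚ) : ℝ) = (((i : ℕ) : ℝ) + 1) / ((m : ℝ) + 1) := fun i => by
    simp only [hxdef]; push_cast; ring
  have hy'R : ∀ j : Fin m, ((y' j : ℚ) : ℝ) = (((j : ℕ) : ℝ) + 1) * s := fun j => by
    simp only [hy'def]; push_cast; ring
  -- the dropped factors are constants
  have hdrop : ∀ j ∈ Finset.univ.filter (fun j => ¬ p j),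
      ∃ hc : IsAlgebraic ℚ (ProbabilityTheory.beta (s : ℝ) (y' j)),
        betaClass s (y' j) = kap (ProbabilityTheory.beta (s : ℝ) (y' j)) hc := fun j hj =>
    betaClass_eq_kap_of_fract_eq_zero s (y' j) hs (hy'pos j) (hfract_drop j (Finset.mem_filter.mp hj).2)
  obtain ⟨hc₀, ec₀⟩ := prod_eq_kap_prod (Finset.univ.filter fun j => ¬ p j) (fun j => betaClass s (y' j))
    (fun j => ProbabilityTheory.beta (s : ℝ) (y' j)) hdrop
  have hmain : ∏ i : Fin m, ProbabilityTheory.beta ((x i : ℚ) : ℝ) (s : ℝ) =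
      κ * ∏ j : Fin m, ProbabilityTheory.beta (s : ℝ) (y' j) := by
    have h0 := prod_beta_mult m hsR
    simp only [hxR]
    rw [h0]
    congr 1
    exact Finset.prod_congr rfl fun j _ => by rw [hy'R]
  have hD : DeligneIdentity 0 x y x'' y''
      (κ * (∏ j ∈ Finset.univ.filter (fun j => ¬ p j), ProbabilityTheory.beta (s : ℝ) (y' j))) := by
    unfold DeligneIdentity
    rw [pow_zero, mul_one]
    simp only [hydef, hx''def, hy''def]
    rw [hmain, ← Finset.prod_filter_mul_prod_filter_not Finset.univ p, hprodK]
    ring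
  -- the crux in canonical form, for the reduced pair
  have E := (gammaHodgeSector_iff_canonical.mp h) m _ 0 x y x'' y''
    (κ * (∏ j ∈ Finset.univ.filter (fun j => ¬ p j), ProbabilityTheory.beta (s : ℝ) (y' j))) hx hx'' hH
    (hκ.mul hc₀) hD
  -- box side
  have hr : IsCubeBetaRep x y r := isCubeBetaRep_multBox m s r hrd hri
  have e1 : toFormalPeriod (of r) = toFormalPeriod (of (cubeRep x y hx.pos)) :=
    (equivalent_cubeRep_of_isCubeBetaRep hx.pos hr).toFormalPeriod_eq
  have e2 : toFormalPeriod (of (ballCubeRep 0 x'' y''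
        (κ * (∏ j ∈ Finset.univ.filter (fun j => ¬ p j), ProbabilityTheory.beta (s : ℝ) (y' j)))
        (hκ.mul hc₀) hx''.pos)) =
      kap (κ * (∏ j ∈ Finset.univ.filter (fun j => ¬ p j), ProbabilityTheory.beta (s : ℝ) (y' j)))
        (hκ.mul hc₀) * betaClass (1 / 2) (1 / 2) ^ 0 * ∏ l, betaClass (x'' l) (y'' l) :=
    stub_products.2.1 0 x'' y'' _ (hκ.mul hc₀) _ hx''.pos (isBallCubeRep_ballCubeRep 0 x'' y'' _ _ hx''.pos)
  -- simplex side
  have e3 : toFormalPeriod (of r') =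
      kap κ hκ * ∏ j, toFormalPeriod (of (betaRep s (y' j) hs (hy'pos j))) :=
    bigSimplex_toFormalPeriod m s hs r' hr'd hr'i y' (fun j => rfl)
      (fun j => betaRep s (y' j) hs (hy'pos j)) (fun j => rfl) (fun j => fun _ _ => rfl) hκ
  have e4 : ∏ j, toFormalPeriod (of (betaRep s (y' j) hs (hy'pos j))) = ∏ j, betaClass s (y' j) :=
    Finset.prod_congr rfl fun j _ => (betaClass_eq s (y' j) hs (hy'pos j)).symm
  change of r - of r' ∈ relations
  rw [← toFormalPeriod_eq_iff, e1, E.toFormalPeriod_eq, e2, e3, e4, pow_zero, mul_one,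
    ← Finset.prod_filter_mul_prod_filter_not Finset.univ p (fun j => betaClass s (y' j)), hprodK, ec₀,
    kap_mul κ _ hκ hc₀]
  simp only [hx''def, hy''def]
  ring

/-! ## §7 The containment `GammaHodgeSector ⊇ MultiplicationAccessible` -/

/-- **`GammaHodgeSector (stmt-3742) → MultiplicationAccessible (stmt-12305)`**, unconditionally:
the Γ-Hodge sector CONTAINS the whole pure-Beta multiplication family (off the integral locus by
`multiplicationAccessible_of_gammaHodgeSector_of_lt_den`; for integer `s` by
`multiplicationAccessible_of_den_eq_one` — no hypothesis; on `2 ≤ den s ≤ m` by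
`multiplicationAccessible_of_gammaHodgeSector_of_two_le_den`). Hence the input
`MultiplicationAccessible` of the line's composition `GammaHodgeSector_of` is NECESSARY, and crux 3
of route TerasomaMultiplication is a sub-crux of crux 5. [cite: Deligne1982HodgeCycles, Thm. 7.18] -/
theorem multiplicationAccessible_of_gammaHodgeSector (h : GammaHodgeSector) :
    MultiplicationAccessible := by
  intro m s hm hs r r' hrd hri hr'd hr'i
  rcases lt_or_ge m s.den with hlt | hge
  · exact multiplicationAccessible_of_gammaHodgeSector_of_lt_den h m s hm hs hlt r r' hrd hri hr'd hr'i
  · rcases Nat.lt_or_ge s.den 2 with h1 | h2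
    · have hd : s.den = 1 := by have := s.den_pos; omega
      exact multiplicationAccessible_of_den_eq_one m s hs hd r r' hrd hri hr'd hr'i
    · exact multiplicationAccessible_of_gammaHodgeSector_of_two_le_den h m s hm hs h2 r r' hrd hri
        hr'd hr'i

/-- The same containment from the verbatim copy of the crux in route `MotivatedMoves`
(stmt-KontsevichZagierPeriods-3742 is shared; the two route decls have the same body).
[cite: Deligne1982HodgeCycles, Thm. 7.18] -/
theorem multiplicationAccessible_of_gammaHodgeSector'
    (h : Summit.KontsevichZagierPeriods.KontsevichZagierPeriods.Theses.MotivatedMoves.GammaHodgeSector) :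
    MultiplicationAccessible :=
  multiplicationAccessible_of_gammaHodgeSector h

/-- **Crux 5 is equivalent to "crux 3 and crux 5"**: `GammaHodgeSector ↔
(MultiplicationAccessible ∧ GammaHodgeSector)` — the bookkeeping form of the containment for the
route's frame. [cite: Deligne1982HodgeCycles, Thm. 7.18] -/
theorem gammaHodgeSector_iff_and_multiplicationAccessible :
    GammaHodgeSector ↔ (MultiplicationAccessible ∧ GammaHodgeSector) :=
  ⟨fun h => ⟨multiplicationAccessible_of_gammaHodgeSector h, h⟩, fun h => h.2⟩


end Summit.KontsevichZagierPeriods.GammaHodgeSectorKO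

end
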